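import Summits.CriticalPhenomena.PercolationContinuityZ3.Theorems.PercNearOneGluingNoHeavyLowerTailKnQuestion8CoefficientwiseCoreClassKernelMixReducedKleitman

/-!
# Two-stage charging: the row-to-layer summation behind the cycle step of the two-type theorem

Support file (`--supports stmt-CriticalPhenomena-4575`, closed), prover `prim-cplus-coupling` (gen 66).  No definitions, no notations,
no named facts, no sorries; standard axioms.  Memo `prim-cplus-coupling/A5-COUPLING-gen66.md` §2 (THEOREM A).

Context.  The two-type theorem (JP/(X2) on bouquets of cycles) is proved by induction on the cycles with the invariant
H(X): for every exact level pair the collision pairs `(x₁,x₂)` of the canonical matchings can be counted against the witness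
space: `#{collisions whose joint upper cone lies in U} ≤ #(U ∩ NF_X)` for every upper set `U`.  On a product `Z = X × Y`
(`Y` the new cycle) the collisions of `Z` split into ROWS indexed by the target coordinate `y* ∈ NE_Y`; in each row the
`X`-components satisfy H(X), and every collision of row `y*` has both `Y`-sources below a LAYER `λ(y*)`, where
`λ : NE_Y → NF_Y` is injective (identity off the 'chain', the chain shift on it).  This file proves the resulting abstract
counting step `two_stage_charging`: under exactly these hypotheses H holds on `Z` with witness space `NF_X ×ˢ NF_Y`.
The cycle-specific facts (bi-discipline, exactness of the chain rows, the bijection `λ`) are discharged elsewhere.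
[cite: KozmaNitzan2024, Questions 8–9 (§5.5 p. 36) (context); Harris 1960; Kleitman 1966]
-/

namespace Summit.CriticalPhenomena.PercolationContinuityZ3.Theorems.Coefficientwise.TwoStageCharging

open Finset ReducedKleitman

variable {X Y : Type*} [Fintype X] [DecidableEq X] [Preorder X] [Fintype Y] [DecidableEq Y] [Preorder Y]

omit [Fintype Y] in
/-- A right fibre of an upper set of `X × Y` is an upper set of `X`. -/
theorem isUpperSet_fibR {W : Finset (X × Y)} (hW : IsUpperSet (W : Set (X × Y))) (v : Y) :
    IsUpperSet ((fibR W v : Finset X) : Set X) := by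
  intro a b hab ha
  rw [mem_coe, mem_fibR] at ha ⊢
  exact hW (Prod.mk_le_mk.mpr ⟨hab, le_rfl⟩) ha

open Classical in
/-- **Two-stage charging** (abstract cycle step of THEOREM A, memo gen 66 §2).  Let `Coll` be a finite set of pairs of points
of `X × Y` ("collisions"), each assigned a row `row c ∈ NEY`, and let `λ : Y → Y` be injective on `NEY` with values in `NFY`
such that both `Y`-components of every collision lie below `λ (row c)`.  If in every row the `X`-components satisfy the
H-bound — the number of collisions of the row whose common upper `X`-cone lies inside an upper set `U` is at most
`#(U ∩ NFX)` — then the collisions of `Z = X × Y` satisfy the H-bound with witness space `NFX ×ˢ NFY`: for every upper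
set `W` of `X × Y`, `#{c ∈ Coll | ↑c.1 ∩ ↑c.2 ⊆ W} ≤ #(W ∩ NFX ×ˢ NFY)`.
[cite: KozmaNitzan2024, Questions 8–9 (§5.5 p. 36) (context); Harris 1960; Kleitman 1966] -/
theorem two_stage_charging (NFX : Finset X) (NFY NEY : Finset Y)
    (Coll : Finset ((X × Y) × (X × Y))) (row : (X × Y) × (X × Y) → Y) (lam : Y → Y)
    (hrow : ∀ c ∈ Coll, row c ∈ NEY)
    (hlam : Set.InjOn lam (NEY : Set Y)) (hlamNF : ∀ y ∈ NEY, lam y ∈ NFY)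
    (hyj : ∀ c ∈ Coll, c.1.2 ≤ lam (row c) ∧ c.2.2 ≤ lam (row c))
    (hX : ∀ y ∈ NEY, ∀ U : Finset X, IsUpperSet (U : Set X) →
      ((Coll.filter (fun c => row c = y)).filter
          (fun c => ∀ p : X, c.1.1 ≤ p → c.2.1 ≤ p → p ∈ U)).card ≤ (U ∩ NFX).card)
    (W : Finset (X × Y)) (hW : IsUpperSet (W : Set (X × Y))) :
    (Coll.filter (fun c => ∀ q : X × Y, c.1 ≤ q → c.2 ≤ q → q ∈ W)).card ≤ (W ∩ NFX ×ˢ NFY).card := by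
  set good : (X × Y) × (X × Y) → Prop := fun c => ∀ q : X × Y, c.1 ≤ q → c.2 ≤ q → q ∈ W with hgood
  set S := Coll.filter good with hS
  -- (1) split the good collisions by row
  have hmaps : ∀ c ∈ S, row c ∈ NEY := fun c hc => hrow c (mem_filter.mp hc).1
  have hsplit : S.card = ∑ y ∈ NEY, (S.filter (fun c => row c = y)).card :=
    card_eq_sum_card_fiberwise hmaps
  -- (2) each row is bounded by the X-hypothesis at the layer λ y
  have hrowbd : ∀ y ∈ NEY, (S.filter (fun c => row c = y)).card ≤ (fibR W (lam y) ∩ NFX).card := by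
    intro y hy
    refine le_trans (card_le_card ?_) (hX y hy (fibR W (lam y)) (isUpperSet_fibR hW (lam y)))
    intro c hc
    rw [mem_filter] at hc
    obtain ⟨hcS, hcy⟩ := hc
    obtain ⟨hcC, hcg⟩ := mem_filter.mp hcS
    refine mem_filter.mpr ⟨mem_filter.mpr ⟨hcC, hcy⟩, ?_⟩
    intro p h1 h2
    rw [mem_fibR]
    have hy1 := (hyj c hcC).1
    have hy2 := (hyj c hcC).2
    rw [hcy] at hy1 hy2
    exact hcg (p, lam y) (Prod.mk_le_mk.mpr ⟨h1, hy1⟩) (Prod.mk_le_mk.mpr ⟨h2, hy2⟩)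
  -- (3) sum over rows, reindex by the injective λ into NFY
  have hsum1 : ∑ y ∈ NEY, (S.filter (fun c => row c = y)).card ≤ ∑ y ∈ NEY, (fibR W (lam y) ∩ NFX).card :=
    sum_le_sum hrowbd
  have hsum2 : ∑ y ∈ NEY, (fibR W (lam y) ∩ NFX).card = ∑ v ∈ NEY.image lam, (fibR W v ∩ NFX).card := by
    rw [sum_image]
    intro a ha b hb hab
    exact hlam (mem_coe.mpr ha) (mem_coe.mpr hb) hab
  have himg : NEY.image lam ⊆ NFY := by
    intro v hv
    obtain ⟨y, hy, rfl⟩ := mem_image.mp hv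
    exact hlamNF y hy
  have hsum3 : ∑ v ∈ NEY.image lam, (fibR W v ∩ NFX).card ≤ ∑ v ∈ NFY, (fibR W v ∩ NFX).card :=
    sum_le_sum_of_subset_of_nonneg himg (fun _ _ _ => Nat.zero_le _)
  -- (4) the layer sums count W ∩ NFX × NFY fibrewise
  have hfib : ∀ v ∈ NFY, (fibR W v ∩ NFX).card = ((W ∩ NFX ×ˢ NFY).filter (fun q => q.2 = v)).card := by
    intro v hv
    refine card_bij (fun x _ => (x, v)) ?_ ?_ ?_
    · intro x hx
      obtain ⟨hxW, hxN⟩ := mem_inter.mp hx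
      rw [mem_fibR] at hxW
      exact mem_filter.mpr ⟨mem_inter.mpr ⟨hxW, mem_product.mpr ⟨hxN, hv⟩⟩, rfl⟩
    · intro a _ b _ h
      exact (Prod.mk.inj h).1
    · intro q hq
      obtain ⟨hqW, hqv⟩ := mem_filter.mp hq
      obtain ⟨hqW', hqN⟩ := mem_inter.mp hqW
      refine ⟨q.1, ?_, ?_⟩
      · refine mem_inter.mpr ⟨?_, (mem_product.mp hqN).1⟩
        rw [mem_fibR, ← hqv]
        exact hqW'
      · rw [← hqv]
  have hsum4 : ∑ v ∈ NFY, (fibR W v ∩ NFX).card = (W ∩ NFX ×ˢ NFY).card := by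
    rw [sum_congr rfl hfib]
    symm
    exact card_eq_sum_card_fiberwise (fun q hq => (mem_product.mp (mem_inter.mp hq).2).2)
  calc S.card = ∑ y ∈ NEY, (S.filter (fun c => row c = y)).card := hsplit
    _ ≤ ∑ y ∈ NEY, (fibR W (lam y) ∩ NFX).card := hsum1
    _ = ∑ v ∈ NEY.image lam, (fibR W v ∩ NFX).card := hsum2
    _ ≤ ∑ v ∈ NFY, (fibR W v ∩ NFX).card := hsum3
    _ = (W ∩ NFX ×ˢ NFY).card := hsum4

end Summit.CriticalPhenomena.PercolationContinuityZ3.Theorems.Coefficientwise.TwoStageCharging
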